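import Literature.Computability.AlgebraicComplexity.BorderRankMatMulThreeTriple
import Literature.Computability.AlgebraicComplexity.BorderRankMatMulThreeEnumData
import Mathlib.Tactic.IntervalCases
import HarnessLib

/-!
# Borel-fixed candidates of `⟨3,3,3⟩`: kernel run of the `(111)` test, part 1

Topic `Literature/Computability/AlgebraicComplexity`. The kernel evaluates the certified bound
`MatMul3.Ker.bound111` of `BorderRankMatMulThreeTriple.lean` on the survivor triples
`(S_0, S_y, S_z)`, `0 ≤ y < 4`, `z < 8`, of `MatMul3.survivors8`
(`BorderRankMatMulThreeEnumData.lean`) and finds it `≤ 15` (`decide +kernel`, one theorem per `y`,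
sized to the default heartbeat budget; the sixteen parts are assembled in
`BorderRankMatMulThreeTripleRun.lean`). Soundness of the bound is
`MatMul3.finrank_tripleInter_le_bound111` (`BorderRankMatMulThreeTripleSound.lean`).

## References

* A. Conner, A. Harper, J. M. Landsberg, *New lower bounds for matrix multiplication and `det₃`*,
  Forum Math. Pi 11 (2023) e17, arXiv:1911.07981 — §6 ("none pass the (111) test"). [ConnerHarperLandsberg2023]
-/

namespace Literature.Computability.AlgebraicComplexity

namespace BorderApolarity

namespace MatMul3

/-- Kernel run of the `(111)` bound on `(S_0, S_0, S_z)`, `z < 8`. [cite: ConnerHarperLandsberg2023, §6] -/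
theorem tripleRun_0_0 : ∀ z : ℕ, z < 8 →
    Ker.bound111 (survivors8.getD 0 []) (survivors8.getD 0 []) (survivors8.getD z []) ≤ 15 := by
  decide +kernel

/-- Kernel run of the `(111)` bound on `(S_0, S_1, S_z)`, `z < 8`. [cite: ConnerHarperLandsberg2023, §6] -/
theorem tripleRun_0_1 : ∀ z : ℕ, z < 8 →
    Ker.bound111 (survivors8.getD 0 []) (survivors8.getD 1 []) (survivors8.getD z []) ≤ 15 := by
  decide +kernel

/-- Kernel run of the `(111)` bound on `(S_0, S_2, S_z)`, `z < 8`. [cite: ConnerHarperLandsberg2023, §6] -/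
theorem tripleRun_0_2 : ∀ z : ℕ, z < 8 →
    Ker.bound111 (survivors8.getD 0 []) (survivors8.getD 2 []) (survivors8.getD z []) ≤ 15 := by
  decide +kernel

/-- Kernel run of the `(111)` bound on `(S_0, S_3, S_z)`, `z < 8`. [cite: ConnerHarperLandsberg2023, §6] -/
theorem tripleRun_0_3 : ∀ z : ℕ, z < 8 →
    Ker.bound111 (survivors8.getD 0 []) (survivors8.getD 3 []) (survivors8.getD z []) ≤ 15 := by
  decide +kernel

/-- **Kernel run, part 1**: the `(111)` bound on `(S_0, S_y, S_z)` is `≤ 15` for `0 ≤ y < 4`,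
`z < 8`. [cite: ConnerHarperLandsberg2023, §6] -/
theorem tripleRun_0_lo (y z : ℕ) (hy : y < 4) (hz : z < 8) :
    Ker.bound111 (survivors8.getD 0 []) (survivors8.getD y []) (survivors8.getD z []) ≤ 15 := by
  interval_cases y
  exacts [tripleRun_0_0 z hz, tripleRun_0_1 z hz, tripleRun_0_2 z hz, tripleRun_0_3 z hz]

end MatMul3

end BorderApolarity

end Literature.Computability.AlgebraicComplexity
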